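import Summits.RiemannHypothesis.RiemannHypothesis.Theorems.TiltedLandingLaw421R3BotQ

/-! # law421 PURSE NODE — the round-3 node `RestSuccBotQ → RestRateBotQ → TiltedLandingLaw421` RE-CUT WITH A GENERIC DEPTH PURSE `P` — C4 «kernel desk» rh-idea-6 g29
SUPPORT module for crux `TiltedLandingLaw421` (stmt-RiemannHypothesis-24774), `--supports … --as helper` only: proves no stub, no crux; fully proved (no `sorry`).
CONTEXT: C2 RIDER-94 (numerical counterexample CANDIDATES to the crux AS TYPED: right-void glide, margin ≈ −0.25·c + 10 on the N4c family; uncertified) puts a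
possible RESTATEMENT of 24774 with a larger depth purse on the director's / tenure's table. The W-07/W-08 chain hard-codes the purse `4·hmax/s + (Hs/s)² + B + 1`
on the RATE side only. THIS FILE re-cuts the TOP of the chain once and for all with the purse as a PARAMETER `P : Purse` (a function of the frame data
`f, x₀, s, hmax, R, Hs, B`): `Law421P P` = the crux text verbatim with `(k : ℝ) ≤ P …` (`law421P_typed_iff : Law421P typedPurse ↔ TiltedLandingLaw421 := Iff.rfl`);
`RestRateBotPQ P` = stub text 2 verbatim with right-hand side `P …` (`restRateBotPQ_rate_iff : RestRateBotPQ ratePurseQ ↔ RestRateBotQ := Iff.rfl`); and the node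
★ `law421P_of_succ_ratePQ : RestSuccBotQ → RestRateBotPQ P → Law421P P` for EVERY purse `P` (pre-horizon depth bound, horizon bound, landing via `landLe3_readyR2`,
exit via `analyticHeredity_landed` — the SUCC stub is untouched and purse-free). Consistency: `law421_of_succ_ratePQ_typed` recovers the tree node `law421T_of_succ_rateQ`.
So a restated crux with purse `P′` costs exactly: the new decl (= `Law421P P′` unfolded), this node at `P := P′`, and the books' capital constant. Also carried (from the
MENU file `law421-purseMenu-…g29.lean`, superseded by this file for landing purposes): `kappaPurse`, `voidWidth`, `voidPurse`, `addPurse`, monotonicity, `adjacent_void_le`.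
K = kernel-checked lemmas about MODEL sockets, not ζ/Ξ. Typed ≠ proved; which purse (if any) makes the RATE stub TRUE is open analysis. RH is NOT proved; 24774 OPEN. -/

namespace RhW08.PurseP

open Complex
open RhIdea6.G17.W07C7 RhIdea6.G17.W07C7.Rev6 RhIdea6.G18.W07C8.Law421BirthS RhIdea6.G19.W07C11.Seam
open RhIdea6.G20.W07C12.Frac RhIdea6.G20.W07C12.StColP RhW07.C12.FieldSplit RhIdea6.G21.W07C13.TentMax
open RhW07.C14.TwoSided RhW07.C14.Classes RhW07.C14.Lineage RhW07.C14.Booking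
open RhW07.C13.Heredity RhIdea6.G22.W07C15pre.Injection RhW07.E3.Cell
open RhW07.E3.Lit
open RhW08.Round1 RhW08.StSwap RhW08.Round2 RhW08.QuadW
open RhW08.SealSwap (PBot)
open RhW08.SealSwapQ
open Summit.RiemannHypothesis.RiemannHypothesis.Theorems.Splittings.EarlyAppointmentsLocalFourierPolya (exists_nonLaguerre_critical_of_boundary_sign)

section Purses

/-- A DEPTH PURSE: the admissible number of levels as a function of the frame data `(f, x₀, s, hmax, R, Hs, B)`. -/
abbrev Purse : Type := (ℂ → ℂ) → ℝ → ℝ → ℝ → ℝ → ℝ → ℕ → ℝ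

/-- The TYPED purse of stmt-24774 (crux order): `4·hmax/s + (Hs/s)² + B + 1`. -/
noncomputable def typedPurse : Purse := fun _ _ s hmax _ Hs B => 4 * hmax / s + (Hs / s) ^ 2 + B + 1

/-- The same purse in the term order of the tree's `RestRateBotQ`: `(Hs/s)² + B + 1 + 4·hmax/s`. -/
noncomputable def ratePurseQ : Purse := fun _ _ s hmax _ Hs B => (Hs / s) ^ 2 + (B : ℝ) + 1 + 4 * hmax / s

/-- (κ) coefficient `κ` on the column budget: `4·hmax/s + (Hs/s)² + κ·B + 1`. -/
noncomputable def kappaPurse (κ : ℝ) : Purse := fun _ _ s hmax _ Hs B => 4 * hmax / s + (Hs / s) ^ 2 + κ * B + 1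

/-- (α) the VOID WIDTH of `f` in the frame: the supremum of the lengths `V ≥ 0` of real open intervals `(a, a + V) ⊆ [x₀ − R, x₀ + R]` free of zeros of `f`. -/
noncomputable def voidWidth (f : ℂ → ℂ) (x₀ R : ℝ) : ℝ :=
  sSup {V : ℝ | 0 ≤ V ∧ ∃ a : ℝ, x₀ - R ≤ a ∧ a + V ≤ x₀ + R ∧ ∀ x : ℝ, a < x → x < a + V → f (x : ℂ) ≠ 0}

/-- (α) void-charged purse: `4·hmax/s + (Hs/s)² + B + 1 + c·voidWidth/s`. -/
noncomputable def voidPurse (c : ℝ) : Purse := fun f x₀ s hmax R Hs B => 4 * hmax / s + (Hs / s) ^ 2 + B + 1 + c * voidWidth f x₀ R / s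

/-- Sum of two purses. -/
noncomputable def addPurse (P Q : Purse) : Purse := fun f x₀ s hmax R Hs B => P f x₀ s hmax R Hs B + Q f x₀ s hmax R Hs B

/-- (K) the two orders of the typed purse agree. -/
theorem ratePurseQ_eq_typedPurse : ratePurseQ = typedPurse := by
  funext f x₀ s hmax R Hs B
  simp only [ratePurseQ, typedPurse]
  ring

/-- (K) `0 ≤ voidWidth f x₀ R`. -/
theorem voidWidth_nonneg (f : ℂ → ℂ) (x₀ R : ℝ) : 0 ≤ voidWidth f x₀ R := by
  unfold voidWidth
  exact Real.sSup_nonneg (fun V hV => hV.1)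

/-- (K) `typedPurse ≤ kappaPurse κ` pointwise for `κ ≥ 1`. -/
theorem typedPurse_le_kappaPurse {κ : ℝ} (hκ : 1 ≤ κ) (f : ℂ → ℂ) (x₀ s hmax R Hs : ℝ) (B : ℕ) :
    typedPurse f x₀ s hmax R Hs B ≤ kappaPurse κ f x₀ s hmax R Hs B := by
  simp only [typedPurse, kappaPurse]
  have hB : (0 : ℝ) ≤ (B : ℝ) := Nat.cast_nonneg B
  nlinarith

/-- (K) `typedPurse ≤ voidPurse c` pointwise for `c ≥ 0` on frames with `0 < s`. -/
theorem typedPurse_le_voidPurse {c : ℝ} (hc : 0 ≤ c) (f : ℂ → ℂ) (x₀ : ℝ) {s : ℝ} (hs : 0 < s) (hmax R Hs : ℝ) (B : ℕ) :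
    typedPurse f x₀ s hmax R Hs B ≤ voidPurse c f x₀ s hmax R Hs B := by
  simp only [typedPurse, voidPurse]
  have h0 : 0 ≤ c * voidWidth f x₀ R / s := div_nonneg (mul_nonneg hc (voidWidth_nonneg f x₀ R)) hs.le
  linarith

end Purses

section Law

/-- ★ THE CRUX WITH A GENERIC PURSE `P`: token-identical to `Summit.…EarlyAppointments.TiltedLandingLaw421` except that the depth bound reads `(k : ℝ) ≤ P f x₀ s hmax R Hs B`. -/
def Law421P (P : Purse) : Prop :=
  ∀ (η : ℝ) (f : ℂ → ℂ) (x₀ s hmax R Hs : ℝ) (B : ℕ), Differentiable ℂ f → (∀ x : ℝ, (f (x : ℂ)).im = 0) → (∃ A' B' ρ : ℝ, ρ < 2 ∧ ∀ z : ℂ, ‖f z‖ ≤ A' * Real.exp (B' * ‖z‖ ^ ρ)) → 0 < s → 2 * s ≤ hmax → 2 * hmax ≤ R → 3 * hmax < R → 0 ≤ Hs → (∀ w : ℂ, f w = 0 → |w.im| ≤ Hs) → 2 * Hs ≤ R → (∃ w₀ : ℂ, f w₀ = 0 ∧ w₀.im ≠ 0 ∧ w₀.re = x₀ ∧ |w₀.im|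 ≤ hmax) → (∀ r : ℝ, s ≤ r → r ≤ R → (∑ᶠ u ∈ {u : ℂ | f u = 0 ∧ |u.re - x₀| ≤ r}, ((analyticOrderAt f u).toNat : ℝ)) - 2 * r / s ≤ B) → (∀ r : ℝ, s ≤ r → r ≤ R → |(∑ᶠ u ∈ {u : ℂ | f u = 0 ∧ x₀ < u.re ∧ u.re ≤ x₀ + r}, ((analyticOrderAt f u).toNat : ℝ)) - r / s| ≤ 1 + B ∧ |(∑ᶠ u ∈ {u : ℂ | f u = 0 ∧ x₀ - r ≤ u.re ∧ u.re < x₀}, ((analyticOrderAt f u).toNat : ℝ)) - r / s| ≤ 1 + B) → 0 ≤ η → 2 * η ≤ 1 → (∀ w : ℂ, |w.re - x₀| ≤ R / 2 → |w.im| ≤ hmax → f w ≠ 0 → ‖deriv f w / f w - ∑ᶠ u ∈ {u : ℂ | f u = 0 ∧ |u.re - w.re| < R / 2}, ((analyticOrderAt f u).toNat : ℂ) * (w - u)⁻¹‖ ≤ η / s) → ∃ k : ℕ, (k : ℝ) ≤ P f x₀ s hmax R Hs B ∧ ∃ x : ℝ, |x - x₀| < ((k : ℝ) + 3) * R / 2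 ∧ ((iteratedDeriv (k + 1) f (x : ℂ)).re = 0 ∧ (iteratedDeriv k f (x : ℂ)).re ≠ 0 ∧ 0 ≤ (iteratedDeriv k f (x : ℂ)).re * (iteratedDeriv (k + 2) f (x : ℂ)).re)

/-- ★★★ (K) FAITHFULNESS: at the typed purse the generic law IS the crux (definitional). -/
theorem law421P_typed_iff : Law421P typedPurse ↔ Summit.RiemannHypothesis.RiemannHypothesis.Theses.EarlyAppointments.TiltedLandingLaw421 :=
  Iff.rfl

/-- ★★ (K) MONOTONICITY: a pointwise LARGER purse gives a WEAKER law. (Only frames with `0 < s` matter, so the comparison may assume it.) -/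
theorem law421P_mono {P P' : Purse} (hPP' : ∀ (f : ℂ → ℂ) (x₀ s hmax R Hs : ℝ) (B : ℕ), 0 < s → P f x₀ s hmax R Hs B ≤ P' f x₀ s hmax R Hs B)
    (h : Law421P P) : Law421P P' := by
  intro η f x₀ s hmax R Hs B hdiff hreal hgrowth hs hsh hhR h3R hHs hstrip hHsR hpair hcol hhalf hη0 hη1 hrem
  obtain ⟨k, hk, hx⟩ := h η f x₀ s hmax R Hs B hdiff hreal hgrowth hs hsh hhR h3R hHs hstrip hHsR hpair hcol hhalf hη0 hη1 hrem
  exact ⟨k, hk.trans (hPP' f x₀ s hmax R Hs B hs), hx⟩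

/-- (K) the typed crux implies the `κ`-law (`κ ≥ 1`) and the void-charged law (`c ≥ 0`). -/
theorem law421P_kappa_of_typed {κ : ℝ} (hκ : 1 ≤ κ) (h : Summit.RiemannHypothesis.RiemannHypothesis.Theses.EarlyAppointments.TiltedLandingLaw421) :
    Law421P (kappaPurse κ) :=
  law421P_mono (fun f x₀ s hmax R Hs B _ => typedPurse_le_kappaPurse hκ f x₀ s hmax R Hs B) (law421P_typed_iff.mpr h)

/-- (K) The void-charged purse `Law421P (voidPurse c)` follows from the typed crux for any `c ≥ 0`. -/
theorem law421P_void_of_typed {c : ℝ} (hc : 0 ≤ c) (h : Summit.RiemannHypothesis.RiemannHypothesis.Theses.EarlyAppointments.TiltedLandingLaw421) :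
    Law421P (voidPurse c) :=
  law421P_mono (fun f x₀ _ hmax R Hs B hs => typedPurse_le_voidPurse hc f x₀ hs hmax R Hs B) (law421P_typed_iff.mpr h)

/-- (K) VOID WIDTH vs THE TYPED ONE-SIDED COUNT (tenure g9, adjacent case): an `x₀`-adjacent zero-free `(x₀, x₀ + V]` with `s ≤ V ≤ R` has `V ≤ (1 + B)·s`. -/
theorem adjacent_void_le {f : ℂ → ℂ} {x₀ s R V : ℝ} {B : ℕ} (hs : 0 < s) (hsV : s ≤ V) (hVR : V ≤ R)
    (hcount : ∀ r : ℝ, s ≤ r → r ≤ R →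
      |(∑ᶠ u ∈ {u : ℂ | f u = 0 ∧ x₀ < u.re ∧ u.re ≤ x₀ + r}, ((analyticOrderAt f u).toNat : ℝ)) - r / s| ≤ 1 + B)
    (hfree : ∀ u : ℂ, f u = 0 → x₀ < u.re → u.re ≤ x₀ + V → False) : V ≤ (1 + B) * s := by
  have h1 := hcount V hsV hVR
  have hempty : {u : ℂ | f u = 0 ∧ x₀ < u.re ∧ u.re ≤ x₀ + V} = ∅ := by
    ext u
    simp only [Set.mem_setOf_eq, Set.mem_empty_iff_false, iff_false, not_and]
    exact fun hu h1 h2 => hfree u hu h1 h2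
  rw [hempty, finsum_mem_empty, zero_sub, abs_neg, abs_of_nonneg (div_nonneg (le_trans hs.le hsV) hs.le)] at h1
  rwa [div_le_iff₀ hs] at h1

end Law

section Descent

/-- The round-2 exit signature with a GENERIC purse: token-identical to `RhW08.StSwap.DescentSig3` except `(j : ℝ) ≤ P f x₀ s hmax R Hs B`. -/
def DescentSigP (P : Purse) : Prop := ∀ (η : ℝ) (f : ℂ → ℂ) (x₀ s hmax R Hs : ℝ) (B : ℕ),
  EngineHyps5 2 η f x₀ s hmax R Hs B →
    ∃ j : ℕ, (j : ℝ) ≤ P f x₀ s hmax R Hs B ∧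
      ((iteratedDeriv j f ≠ 0 ∧ ∃ (α β H : ℝ), x₀ - (j + 3) * R / 2 ≤ α ∧ β ≤ x₀ + (j + 3) * R / 2 ∧ SignWindow (iteratedDeriv j f) α β H) ∨
        ∃ x : ℝ, |x - x₀| < ((j : ℝ) + 3) * R / 2 ∧ NLEventOf f j x)

/-- (K) at the typed purse it IS `DescentSig3` (definitional). -/
theorem descentSigP_typed_iff : DescentSigP typedPurse ↔ DescentSig3 := Iff.rfl

/-- ★★ (K) THE GENERIC EXIT `DescentSigP P → AnalyticHereditySig → Law421P P` (the proof of `law421_of_descentSig3`, purse untouched: window branch via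
`exists_nonLaguerre_critical_of_boundary_sign` at level `k = j`, tilt branch = identity). -/
theorem law421P_of_descentSigP {P : Purse} (hDesc : DescentSigP P) (hHer : AnalyticHereditySig) : Law421P P := by
  intro η f x₀ s hmax R Hs B hdiff hreal hgrowth hs hsh hhR h3R hHs hstrip hHsR hpair hcol hhalf hη0 hη1 hrem
  have hE : EngineHyps5 2 η f x₀ s hmax R Hs B :=
    ⟨hdiff, hreal, hgrowth, hs, hsh, hhR, h3R, hHs, hstrip, hHsR, hpair, hcol, hhalf, hη0, hη1, hrem⟩
  obtain ⟨j, hj, hcase⟩ := hDesc η f x₀ s hmax R Hs B hE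
  rcases hcase with ⟨hnz, α, β, H, hα, hβ, hW⟩ | ⟨x, hx, hev⟩
  · have hC0 : InClass f Hs := ⟨hdiff, hreal, hgrowth, hstrip⟩
    obtain ⟨hlt, hH, hgα, hgβ, hdα, hdβ, htop, hleft, hright, hA, hz⟩ := hW
    have hCj : InClass (iteratedDeriv j f) Hs := hHer f Hs j hHs hC0 hnz
    obtain ⟨x, hxI, hdx, hgx, hsign⟩ :=
      exists_nonLaguerre_critical_of_boundary_sign hCj.1 hCj.2.1 hlt hH hgα hgβ hdα hdβ htop hleft hright hA hz
    have h1 : iteratedDeriv (j + 1) f = deriv (iteratedDeriv j f) := iteratedDeriv_succ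
    have h2 : iteratedDeriv (j + 2) f = deriv (deriv (iteratedDeriv j f)) := by
      show iteratedDeriv (j + 1 + 1) f = _
      rw [iteratedDeriv_succ, iteratedDeriv_succ]
    have hgim : (iteratedDeriv j f (x : ℂ)).im = 0 := hCj.2.1 x
    have hev : NLEventOf f j x := by
      refine ⟨?_, ?_, ?_⟩
      · rw [h1, hdx]; simp
      · intro hre
        exact hgx (Complex.ext (by simpa using hre) (by simpa using hgim))
      · rw [h2]
        have hmul : (iteratedDeriv j f (x : ℂ) * deriv (deriv (iteratedDeriv j f)) (x : ℂ)).re =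
            (iteratedDeriv j f (x : ℂ)).re * (deriv (deriv (iteratedDeriv j f)) (x : ℂ)).re := by
          rw [Complex.mul_re, hgim, zero_mul, sub_zero]
        rw [← hmul]; exact hsign
    refine ⟨j, hj, x, ?_, hev⟩
    rw [abs_sub_lt_iff]
    constructor <;> linarith [hxI.1, hxI.2]
  · exact ⟨j, hj, x, hx, hev⟩

/-- (K) A HORIZON gives the exit: if on every legal frame Ready′ is on at some level `j ≤ P`, then `DescentSigP P` (via the round-2 landing lemma `landLe3_readyR2`,
which is state-blind). -/
theorem descentSigP_of_horizon {P : Purse}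
    (hH : ∀ (η : ℝ) (f : ℂ → ℂ) (x₀ s hmax R Hs : ℝ) (B : ℕ), EngineHyps5 2 η f x₀ s hmax R Hs B →
      ∃ j : ℕ, (j : ℝ) ≤ P f x₀ s hmax R Hs B ∧ ∀ u : ℂ, ReadyR2 η f x₀ s hmax R Hs B j u) :
    DescentSigP P := by
  intro η f x₀ s hmax R Hs B hE
  obtain ⟨j, hj, hall⟩ := hH η f x₀ s hmax R Hs B hE
  obtain ⟨j', hj', hdisj⟩ :=
    landLe3_readyR2 (fun _ _ _ _ _ _ _ _ _ _ => True) η f x₀ s hmax R Hs B hE j 0 trivial (hall 0)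
  have hjj : (j' : ℝ) ≤ (j : ℝ) := by exact_mod_cast hj'
  exact ⟨j', hjj.trans hj, hdisj⟩

end Descent

section Rate

open Classical in
/-- ★ STUB TEXT 2 WITH A GENERIC PURSE: token-identical to `RhW08.SealSwapQ.RestRateBotQ` except that the right-hand side reads `P f x₀ s hmax R Hs B`. -/
def RestRateBotPQ (P : Purse) : Prop :=
  ∀ (η : ℝ) (f : ℂ → ℂ) (x₀ s hmax R Hs : ℝ) (B : ℕ), EngineHyps5 2 η f x₀ s hmax R Hs B →
    ∀ k : ℕ, chargeCount (PTrkSQ PBot) StTrkDQ ReadyR2 η f x₀ s hmax R Hs B k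
        + max (tentMeterTrkD (3 / 2) η f x₀ s hmax R Hs B 0 - injected (PTrkSQ PBot) StTrkDQ ReadyR2 EmptyTrkDQ η f x₀ s hmax R Hs B k) 0
        + 4 * lowH StTrkDQ η f x₀ s hmax R Hs B k / s
        + (∑ j ∈ Finset.range k, (if Charged (PTrkSQ PBot) StTrkDQ ReadyR2 η f x₀ s hmax R Hs B j then 0 else
            4 * (lowH StTrkDQ η f x₀ s hmax R Hs B j - lowH StTrkDQ η f x₀ s hmax R Hs B (j + 1)) / s))
      ≤ P f x₀ s hmax R Hs B

/-- (K) at the rate-order typed purse it IS `RestRateBotQ` (definitional). -/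
theorem restRateBotPQ_rate_iff : RestRateBotPQ ratePurseQ ↔ RestRateBotQ := Iff.rfl

/-- (K) monotonicity of the generic rate stub in the purse. -/
theorem restRateBotPQ_mono {P P' : Purse} (hPP' : ∀ (f : ℂ → ℂ) (x₀ s hmax R Hs : ℝ) (B : ℕ), 0 < s → P f x₀ s hmax R Hs B ≤ P' f x₀ s hmax R Hs B)
    (h : RestRateBotPQ P) : RestRateBotPQ P' := by
  intro η f x₀ s hmax R Hs B hE k
  have hs : 0 < s := hE.2.2.2.1
  exact (h η f x₀ s hmax R Hs B hE k).trans (hPP' f x₀ s hmax R Hs B hs)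

/-- (K) the tree's `RestRateBotQ` is the generic stub at `typedPurse`. -/
theorem restRateBotPQ_of_rateQ (h : RestRateBotQ) : RestRateBotPQ typedPurse := by
  rw [← ratePurseQ_eq_typedPurse]
  exact restRateBotPQ_rate_iff.mpr h

/-- (K) The tree's `RestRateBotQ` follows from `RestRateBotPQ typedPurse` (converse of `restRateBotPQ_of_rateQ`). -/
theorem rateQ_of_restRateBotPQ (h : RestRateBotPQ typedPurse) : RestRateBotQ := by
  rw [← ratePurseQ_eq_typedPurse] at h
  exact restRateBotPQ_rate_iff.mp h

/-- (K) the purse is non-negative on legal frames (the `k = 0` instance: every summand on the left is `≥ 0`). -/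
theorem purse_nonneg_of_ratePQ {P : Purse} (hR : RestRateBotPQ P) {η : ℝ} {f : ℂ → ℂ} {x₀ s hmax R Hs : ℝ} {B : ℕ}
    (hE : EngineHyps5 2 η f x₀ s hmax R Hs B) : 0 ≤ P f x₀ s hmax R Hs B := by
  classical
  have hs : 0 < s := hE.2.2.2.1
  have h0 := hR η f x₀ s hmax R Hs B hE 0
  rw [chargeCount_zero, Finset.sum_range_zero] at h0
  have h1 : 0 ≤ max (tentMeterTrkD (3 / 2) η f x₀ s hmax R Hs B 0
      - injected (PTrkSQ PBot) StTrkDQ ReadyR2 EmptyTrkDQ η f x₀ s hmax R Hs B 0) 0 := le_max_right _ _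
  have h2 : 0 ≤ 4 * lowH StTrkDQ η f x₀ s hmax R Hs B 0 / s :=
    div_nonneg (mul_nonneg (by norm_num) (lowH_nonneg _ _ _ _ _ _ _ _ _ _)) hs.le
  linarith

/-- ★★ (K) PRE-HORIZON DEPTH BOUND at purse `P` (the proof of `preHorizon_depth_leQ` with the two stubs fed directly): if no level `< k` is Ready′ then level `k` is
inhabited and `k + 4·lowH k/s ≤ P`. -/
theorem preHorizon_depth_lePQ {P : Purse} (hS : RestSuccBotQ) (hR : RestRateBotPQ P) {η : ℝ} {f : ℂ → ℂ} {x₀ s hmax R Hs : ℝ} {B : ℕ}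
    (hE : EngineHyps5 2 η f x₀ s hmax R Hs B) {k : ℕ} (hpre : ∀ i : ℕ, i < k → ∀ v : ℂ, ¬ ReadyR2 η f x₀ s hmax R Hs B i v) :
    (∃ u : ℂ, StTrkDQ η f x₀ s hmax R Hs B k u) ∧
      (k : ℝ) + 4 * lowH StTrkDQ η f x₀ s hmax R Hs B k / s ≤ P f x₀ s hmax R Hs B := by
  classical
  have hs : 0 < s := hE.2.2.2.1
  have hSn := hS η f x₀ s hmax R Hs B hE
  have hB := hR η f x₀ s hmax R Hs B hE
  have key : ∀ j : ℕ, j ≤ k → (∃ u : ℂ, StTrkDQ η f x₀ s hmax R Hs B j u) ∧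
      (j : ℝ) ≤ chargeCount (PTrkSQ PBot) StTrkDQ ReadyR2 η f x₀ s hmax R Hs B j
        + ∑ i ∈ Finset.range j, (if Charged (PTrkSQ PBot) StTrkDQ ReadyR2 η f x₀ s hmax R Hs B i then 0 else
            4 * (lowH StTrkDQ η f x₀ s hmax R Hs B i - lowH StTrkDQ η f x₀ s hmax R Hs B (i + 1)) / s) := by
    intro j
    induction j with
    | zero =>
      intro _
      obtain ⟨u, hu, -⟩ := init0Sig_stTrkDQ η f x₀ s hmax R Hs B hE
      refine ⟨⟨u, hu⟩, ?_⟩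
      rw [chargeCount_zero, Finset.sum_range_zero]
      norm_num
    | succ j ih =>
      intro hjk
      have hjlt : j < k := Nat.lt_of_succ_le hjk
      obtain ⟨⟨u, hu⟩, hih⟩ := ih hjlt.le
      rw [chargeCount_succ, Finset.sum_range_succ]
      push_cast
      by_cases hC : Charged (PTrkSQ PBot) StTrkDQ ReadyR2 η f x₀ s hmax R Hs B j
      · obtain ⟨u', hu'⟩ := hSn j hC
        refine ⟨⟨u', hu'⟩, ?_⟩
        rw [if_pos hC, if_pos hC]
        linarith
      · obtain ⟨v, hv, hveq⟩ := exists_isLowest_eq_lowH levelFinite_stTrkDQ upperStates_stTrkDQ hE hu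
        have hnr : ¬ ReadyR2 η f x₀ s hmax R Hs B j v := hpre j hjlt v
        have hP : PTrkSQ PBot η f x₀ s hmax R Hs B j v := by
          by_contra hnP
          exact hC ⟨v, hv, hnr, hnP⟩
        have hSucc : SuccOf (1 / 4) StTrkDQ η f x₀ s hmax R Hs B j v := by
          rcases hP with hσ | hsucc
          · exact alphaSealTrkS_botQ η f x₀ s hmax R Hs B hE j v hv hnr hσ
          · exact hsucc
        obtain ⟨u', hu', hdrop⟩ := hSucc
        have h1 : lowH StTrkDQ η f x₀ s hmax R Hs B (j + 1) ≤ |u'.im| := lowH_le hu'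
        refine ⟨⟨u', hu'⟩, ?_⟩
        rw [if_neg hC, if_neg hC]
        have h2 : 1 ≤ 4 * (lowH StTrkDQ η f x₀ s hmax R Hs B j - lowH StTrkDQ η f x₀ s hmax R Hs B (j + 1)) / s := by
          rw [le_div_iff₀ hs]
          linarith
        linarith
  obtain ⟨hinh, hk⟩ := key k le_rfl
  refine ⟨hinh, ?_⟩
  have hcrd := le_max_right (tentMeterTrkD (3 / 2) η f x₀ s hmax R Hs B 0
    - injected (PTrkSQ PBot) StTrkDQ ReadyR2 EmptyTrkDQ η f x₀ s hmax R Hs B k) 0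
  have h3 := hB k
  linarith

/-- ★★ (K) HORIZON (STOP-TIME) BOUND at purse `P`: on every legal frame Ready′ is on at some level `j ≤ P`. -/
theorem exists_readyR2_lePQ {P : Purse} (hS : RestSuccBotQ) (hR : RestRateBotPQ P) {η : ℝ} {f : ℂ → ℂ} {x₀ s hmax R Hs : ℝ} {B : ℕ}
    (hE : EngineHyps5 2 η f x₀ s hmax R Hs B) :
    ∃ j : ℕ, (j : ℝ) ≤ P f x₀ s hmax R Hs B ∧ ∀ u : ℂ, ReadyR2 η f x₀ s hmax R Hs B j u := by
  classical
  have hs : 0 < s := hE.2.2.2.1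
  have hb : 0 ≤ P f x₀ s hmax R Hs B := purse_nonneg_of_ratePQ hR hE
  by_contra hcon
  have hall : ∀ i : ℕ, i < ⌊P f x₀ s hmax R Hs B⌋₊ + 1 → ∀ v : ℂ, ¬ ReadyR2 η f x₀ s hmax R Hs B i v := by
    intro i hi v hv
    apply hcon
    refine ⟨i, ?_, fun u => stateFree_readyR2 η f x₀ s hmax R Hs B i v u hv⟩
    have h1 : (i : ℝ) ≤ (⌊P f x₀ s hmax R Hs B⌋₊ : ℝ) := by
      exact_mod_cast Nat.lt_succ_iff.mp hi
    exact h1.trans (Nat.floor_le hb)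
  obtain ⟨-, hdepth⟩ := preHorizon_depth_lePQ hS hR hE hall
  have h2 : 0 ≤ 4 * lowH StTrkDQ η f x₀ s hmax R Hs B (⌊P f x₀ s hmax R Hs B⌋₊ + 1) / s :=
    div_nonneg (mul_nonneg (by norm_num) (lowH_nonneg _ _ _ _ _ _ _ _ _ _)) hs.le
  have h3 := Nat.lt_floor_add_one (P f x₀ s hmax R Hs B)
  push_cast at hdepth
  linarith

/-- (K) hence the generic exit from the two stubs. -/
theorem descentSigP_of_succ_ratePQ {P : Purse} (hS : RestSuccBotQ) (hR : RestRateBotPQ P) : DescentSigP P :=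
  descentSigP_of_horizon (fun _ _ _ _ _ _ _ _ hE => exists_readyR2_lePQ hS hR hE)

/-- ★★★ (K) **THE ROUND-3 NODE AT A GENERIC PURSE**: `RestSuccBotQ → RestRateBotPQ P → Law421P P`, for EVERY purse `P` (exit via the landed analytic heredity). -/
theorem law421P_of_succ_ratePQ {P : Purse} (hS : RestSuccBotQ) (hR : RestRateBotPQ P) : Law421P P :=
  law421P_of_descentSigP (descentSigP_of_succ_ratePQ hS hR) analyticHeredity_landed

/-- (K) CONSISTENCY: at the typed purse the generic node recovers the tree node `law421T_of_succ_rateQ` (independent proof path: horizon + `landLe3_readyR2`). -/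
theorem law421_of_succ_ratePQ_typed (hS : RestSuccBotQ) (hR : RestRateBotQ) :
    Summit.RiemannHypothesis.RiemannHypothesis.Theses.EarlyAppointments.TiltedLandingLaw421 :=
  law421P_typed_iff.mp (law421P_of_succ_ratePQ hS (restRateBotPQ_of_rateQ hR))

/-- (K) the κ-instance by names: `RestSuccBotQ → RestRateBotPQ (kappaPurse κ) → Law421P (kappaPurse κ)`. -/
theorem law421Kappa_of_succ_rate (κ : ℝ) (hS : RestSuccBotQ) (hR : RestRateBotPQ (kappaPurse κ)) : Law421P (kappaPurse κ) :=
  law421P_of_succ_ratePQ hS hR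

/-- (K) the void-instance by names: `RestSuccBotQ → RestRateBotPQ (voidPurse c) → Law421P (voidPurse c)`. -/
theorem law421Void_of_succ_rate (c : ℝ) (hS : RestSuccBotQ) (hR : RestRateBotPQ (voidPurse c)) : Law421P (voidPurse c) :=
  law421P_of_succ_ratePQ hS hR

end Rate

end RhW08.PurseP
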